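import Summits.PneNP.PneNP.Theorems.ExpanderLinearGeneratorsGridRoutingFormulas

/-!
# PneNP / ExpanderLinearGenerators — the local derivations of the grid routing reduction: exclusion
chains and the substituted Tseitin clauses from `¬⋀ontoPHP`

Route `PneNP/ExpanderLinearGenerators`, support for crux stmt-PneNP-11443. Fourth file of the
Urquhart–Fu / Ben-Sasson reduction. With `R' = ⋀ ontoPHP^{k+2}_{k+1}` and the routing substitution
`σ` (`…GridRoutingFormulas`):

* `rowExclS` — the chains `⊢ ¬p_{uw} ∨ ¬rowOR k u v, ¬R'` (`w < v`): by downward induction on `v`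
  from `rowOR k u (k+1) = ⊥`, each step a skeleton step from the functional clause
  `¬p_{uw} ∨ ¬p_{uv}` and the previous link; `colExclS` — dually `⊢ ¬p_{uw} ∨ ¬colOR k v w, ¬R'`
  (`u < v`) from the hole (injectivity) clauses;
* `gridClauseS` — for every clause `K` of the equation of a grid point `g(u,w)`:
  `⊢ σ(K), ¬R'` (skeleton step from the two exclusions at `(u, w)`, `skel_tautology_grid`);
* `pigeonClauseS`, `holeClauseS` — the same for the terminal equations (from the pigeon / onto
  clause of the terminal);
* `gridSystemClauseS` — hence `⊢ σ(K), ¬R'` for EVERY clause `K` of `sumEncoding 1 (gridSystem k)`,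
  in `clauseLines k` lines of size `≤ B` whenever `B ≥ 3000 (k+3)⁴`.

References: A. Urquhart, X. Fu, NDJFL 37 (1996); E. Ben-Sasson, Comput. Complexity 11 (2002), §3.
-/

namespace Summit.PneNP.PneNP.Theorems.GridRouting

set_option linter.dupNamespace false -- `Summit.PneNP.PneNP.…`: summit = sub-problem (D-0017)

open Finset Literature.Computability.Complexity.PropForm
open Literature.Computability.Complexity (PropForm Clause CNF Literal eventually_pow_lt_two_rpow_rpow)
open Literature.Computability.MetaComplexity Literature.Computability.MetaComplexity.TextbookFrege
open Literature.Computability.MetaComplexity.KrajicekRamsey (litOf clauseOf ofCNF_eq_conjList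
  subst_disjList size_subst_le altDepthAux_subst_le dd_clauseOf_le clauseExtractS dd_neg_ofCNF_le)

/-! ### The bijective pigeonhole side -/

variable (n : ℕ)

/-- Sums of bounded lists. [folklore] -/
theorem sum_le_length_mul {l : List ℕ} {b : ℕ} (h : ∀ x ∈ l, x ≤ b) : l.sum ≤ l.length * b := by
  have := List.sum_le_card_nsmul l b h; simpa using this

/-- The number of clauses of `ontoPHP^{n+1}_n` is at most `2 (n+2)³`. [folklore] -/
theorem length_ontoPigeonholeCNF_le : (ontoPigeonholeCNF (n + 1) n).length ≤ 2 * (n + 2) ^ 3 := by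
  have hch : (n + 1).choose 2 ≤ (n + 1) * (n + 1) := by
    rw [Nat.choose_two_right]
    exact (Nat.div_le_self _ _).trans (Nat.mul_le_mul_left _ (Nat.sub_le _ _))
  -- the functional clauses: `Σ_i Σ_{j'<n} j' ≤ (n+1) n²`
  have hfun : ((List.range (n + 1)).flatMap fun i => (List.range n).flatMap fun j' =>
      (List.range j').map fun j => [(i * n + j, false), (i * n + j', false)]).length ≤
      (n + 1) * (n * n) := by
    rw [List.length_flatMap]
    refine (sum_le_length_mul (b := n * n) fun x hx => ?_).trans (by simp)
    obtain ⟨i, -, rfl⟩ := List.mem_map.1 hx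
    simp only [List.length_flatMap]
    refine (sum_le_length_mul (b := n) fun y hy => ?_).trans (by simp)
    obtain ⟨j', hj', rfl⟩ := List.mem_map.1 hy
    simp only [List.length_map, List.length_range]
    exact (List.mem_range.1 hj').le
  simp only [ontoPigeonholeCNF, List.length_append, length_pigeonholeCNF, List.length_map,
    List.length_range]
  nlinarith [hfun, hch]

/-- Every clause of `ontoPHP^{n+1}_n` has at most `n + 1` literals. [folklore] -/
theorem length_le_of_mem_ontoPigeonholeCNF {c : Clause ℕ} (hc : c ∈ ontoPigeonholeCNF (n + 1) n) :
    c.length ≤ n + 1 := by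
  rcases mem_ontoPigeonholeCNF_iff.1 hc with h | ⟨i, -, j', hj', j, -, rfl⟩ | ⟨j, -, rfl⟩
  · rcases KEval.mem_pigeonholeCNF_iff.1 h with ⟨i, -, rfl⟩ | ⟨j, hj, i', -, i, -, rfl⟩
    · simp
    · simp; omega
  · simp; omega
  · simp

/-- The rendering of a clause with `t` literals has size at most `3t + 1`. [folklore] -/
theorem size_clauseOf_le (c : Clause ℕ) : (clauseOf c).size ≤ 3 * c.length + 1 := by
  induction c with
  | nil => simp [clauseOf_nil, size]
  | cons l c ih =>
    rw [clauseOf_cons, size, List.length_cons]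
    have : (litOf l).size ≤ 2 := by
      unfold litOf; split_ifs <;> simp [size]
    omega

/-- Size of the rendered bijective pigeonhole clauses: `msum ≤ 8 (n+2)⁴`. [folklore] -/
theorem msum_ontoPhpClauses_le :
    msum ((ontoPigeonholeCNF (n + 1) n).map clauseOf) ≤ 8 * (n + 2) ^ 4 := by
  have h1 : msum ((ontoPigeonholeCNF (n + 1) n).map clauseOf) ≤
      ((ontoPigeonholeCNF (n + 1) n).map clauseOf).length * (3 * (n + 1) + 3) := by
    refine msum_le_length_mul fun X hX => ?_
    obtain ⟨c, hc, rfl⟩ := List.mem_map.1 hX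
    have := size_clauseOf_le c
    have := length_le_of_mem_ontoPigeonholeCNF n hc
    nlinarith
  rw [List.length_map] at h1
  have h2 := length_ontoPigeonholeCNF_le n
  have h3 : 2 * (n + 2) ^ 3 * (3 * (n + 1) + 3) ≤ 8 * (n + 2) ^ 4 := by
    have : 3 * (n + 1) + 3 ≤ 4 * (n + 2) := by omega
    calc 2 * (n + 2) ^ 3 * (3 * (n + 1) + 3) ≤ 2 * (n + 2) ^ 3 * (4 * (n + 2)) :=
          Nat.mul_le_mul_left _ this
      _ = 8 * (n + 2) ^ 4 := by ring
  calc _ ≤ (ontoPigeonholeCNF (n + 1) n).length * (3 * (n + 1) + 3) := h1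
    _ ≤ 2 * (n + 2) ^ 3 * (3 * (n + 1) + 3) := Nat.mul_le_mul_right _ h2
    _ ≤ _ := h3

/-- Size of the rendered bijective pigeonhole CNF. [folklore] -/
theorem size_ontoPhp_le : (ontoPhp n).size ≤ 8 * (n + 2) ^ 4 + 1 := by
  rw [ontoPhp, ofCNF_eq_conjList, size_conjList_eq_msum]
  have := msum_ontoPhpClauses_le n
  omega

/-- The negated rendered CNF has disjunct depth `≤ 4`. [folklore] -/
theorem dd_neg_ontoPhp_le : (neg (ontoPhp n)).dd ≤ 4 := dd_neg_ofCNF_le _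

/-- **Clause extraction for the bijective pigeonhole CNF**, in the shape `⊢ C, ¬⋀ontoPHP` used by
the skeleton steps (`≤ 1400 (n+2)⁴` lines). [Shoenfield 1967, §3.1] [folklore] -/
theorem ontoClauseExtractS {D B : ℕ} {c : Clause ℕ} (hc : c ∈ ontoPigeonholeCNF (n + 1) n)
    (hD : 9 ≤ D) (hB : 200 * (n + 2) ^ 4 ≤ B) :
    BD D B (1400 * (n + 2) ^ 4) (disjList [clauseOf c, neg (ontoPhp n)]) := by
  have hms := msum_ontoPhpClauses_le n
  have h16 : 16 ≤ (n + 2) ^ 4 := by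
    have h2 : 2 ≤ n + 2 := by omega
    calc 16 = 2 ^ 4 := rfl
      _ ≤ (n + 2) ^ 4 := Nat.pow_le_pow_left h2 4
  have hex : BD D B (130 * (8 * (n + 2) ^ 4 + 3)) (disjList [neg (ontoPhp n), clauseOf c]) :=
    clauseExtractS hc (by omega) (by omega) (by omega)
  have hszc : (clauseOf c).size + 1 ≤ 8 * (n + 2) ^ 4 :=
    (size_lt_msum (List.mem_map.2 ⟨c, hc, rfl⟩)).trans_le hms
  have hszR := size_ontoPhp_le n
  refine (subsetN (N := 2) hex ?_ (p := 4) ?_ (by omega) ?_ (by simp) (by simp)).mono ?_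
  · intro X hX
    simp only [List.mem_cons, List.not_mem_nil, or_false] at hX ⊢
    tauto
  · intro X hX
    simp only [List.mem_cons, List.not_mem_nil, or_false] at hX
    rcases hX with rfl | rfl
    · exact (dd_clauseOf_le c).trans (by omega)
    · exact dd_neg_ontoPhp_le n
  · simp only [size_disjList_cons, size_disjList_nil, size]
    omega
  · omega

variable {n}
variable (k : ℕ)

/-! ### Common bounds -/

/-- The global line-size requirement `3000 (k+3)⁴ ≤ B` implies the requirements of the steps.
[folklore] -/
theorem stepB_of_le {B : ℕ} (hB : 3000 * (k + 3) ^ 4 ≤ B) : 2880 * Z₁ k + 8 * SR k + 100 ≤ B := by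
  have h27 : 27 * (k + 3) ≤ (k + 3) ^ 4 := by
    have : 27 ≤ (k + 3) ^ 3 :=
      le_trans (by norm_num) (Nat.pow_le_pow_left (show 3 ≤ k + 3 by omega) 3)
    calc 27 * (k + 3) ≤ (k + 3) ^ 3 * (k + 3) := Nat.mul_le_mul_right _ this
      _ = (k + 3) ^ 4 := by ring
  have h16 : 16 ≤ (k + 3) ^ 4 :=
    le_trans (by norm_num) (Nat.pow_le_pow_left (show 2 ≤ k + 3 by omega) 4)
  simp only [Z₁, SR]
  nlinarith

/-- `200 (k+3)⁴ ≤ B`. [folklore] -/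
theorem extractB_of_le {B : ℕ} (hB : 3000 * (k + 3) ^ 4 ≤ B) : 200 * (k + 1 + 2) ^ 4 ≤ B := by
  have : k + 1 + 2 = k + 3 := by omega
  rw [this]; omega

/-! ### The exclusion chains -/

variable {k}

/-- The base of the chains: `⊢ ¬p ∨ ¬⊥, ¬R'`. [folklore] -/
theorem exclBaseS {D B : ℕ} (p : ℕ) (hD : 13 ≤ D) (hB : 3000 * (k + 3) ^ 4 ≤ B) :
    BD D B 5 (disjList [disj (neg (var p)) (neg (const false)), neg (ontoPhp (k + 1))]) := by
  have hszR := size_ontoPhp_le (k + 1)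
  have e3 : k + 1 + 2 = k + 3 := by omega
  rw [e3] at hszR
  have h16 : 16 ≤ (k + 3) ^ 4 :=
    le_trans (by norm_num) (Nat.pow_le_pow_left (show 2 ≤ k + 3 by omega) 4)
  have h1 : BD D B 1 (neg (const false)) := negBotB (by omega) (by omega)
  have h2 : BD D B 2 (disj (neg (var p)) (neg (const false))) :=
    expanB _ h1 ⟨by simp; omega, by simp only [size]; omega⟩
  have h3 := expan'B (disj (neg (ontoPhp (k + 1))) (const false)) h2 ?_ ?_ ?_
  · simpa [disjList] using h3
  · rw [dd_neg, altDepthAux_one_disj]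
    have := dd_neg_ontoPhp_le (k + 1)
    simp only [dd_const]
    omega
  · simp only [size]; omega
  · simp only [size]; omega

/-- **Row exclusion chain**: `⊢ ¬p_{uw} ∨ ¬rowOR k u v, ¬R'` for `u < k+2`, `w < v`, `v + t = k+1`.
Step: from the functional clause `¬p_{uw} ∨ ¬p_{uv}` of `ontoPHP` and the link at `v + 1`, by the
skeleton `¬x₀ ∨ ¬(x₁ ∨ x₂) ⇐ (¬x₀ ∨ ¬x₁), (¬x₀ ∨ ¬x₂)`. [Ben-Sasson 2002, §3] [folklore] -/
theorem rowExclS {D B : ℕ} (hD : 13 ≤ D) (hB : 3000 * (k + 3) ^ 4 ≤ B) :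
    ∀ (t u w v : ℕ), u < k + 2 → w < v → v + t = k + 1 →
      BD D B (chainLines k t) (disjList [rowExcl k u w v, neg (ontoPhp (k + 1))])
  | 0, u, w, v, _, _, hv => by
    rw [chainLines, rowExcl, rowOR_end (by omega)]
    exact exclBaseS _ hD hB
  | t + 1, u, w, v, hu, hwv, hv => by
    have ih := rowExclS hD hB t u w (v + 1) hu (by omega) (by omega)
    have hvk : v < k + 1 := by omega
    rw [chainLines]
    -- the functional clause `¬p_{uw} ∨ ¬p_{uv}`
    have hmem : [(u * (k + 1) + w, false), (u * (k + 1) + v, false)] ∈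
        ontoPigeonholeCNF (k + 1 + 1) (k + 1) :=
      mem_ontoPigeonholeCNF_iff.2 (Or.inr (Or.inl ⟨u, by omega, v, hvk, w, hwv, rfl⟩))
    have hex := ontoClauseExtractS (D := D) (k + 1) hmem (by omega) (extractB_of_le k hB)
    have hszR := size_ontoPhp_le (k + 1)
    have e : rowExcl k u w v = (disj (neg (var 0)) (neg (disj (var 1) (var 2)))).subst
        (linkSubst (u * (k + 1) + w) (u * (k + 1) + v) (rowOR k u (v + 1))) := by
      rw [rowExcl, rowOR_step hvk]; rfl
    rw [e]
    refine skeletonStep2S (G₁ := clauseOf [(0, false), (1, false)])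
      (G₂ := disj (neg (var 0)) (neg (var 2))) [0, 1, 2] (by decide) (by simp) ?_ ?_ ?_ ?_
      (Z₁ := Z₁ k) (SR := SR k) ?_ (by simp) ?_ (dd_neg_ontoPhp_le _) (by simpa using hszR)
      (by simpa [linkSubst, clauseOf, disjList, litOf, PropForm.subst] using hex)
      (by simpa [linkSubst, rowExcl, PropForm.subst] using ih) hD (stepB_of_le k hB)
    · intro A hA x hx
      simp only [List.mem_cons, List.not_mem_nil, or_false] at hA
      rcases hA with rfl | rfl | rfl <;>
        simp [PropForm.vars, clauseOf, disjList, litOf] at hx <;> simp <;> omega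
    · intro τ h1 h2
      simp only [eval_clauseOf, List.any_cons, List.any_nil, Bool.or_false, Literal.eval,
        PropForm.eval] at h1 h2 ⊢
      revert h1 h2
      cases τ 0 <;> cases τ 1 <;> cases τ 2 <;> simp
    · intro A hA
      simp only [List.mem_cons, List.not_mem_nil, or_false] at hA
      rcases hA with rfl | rfl | rfl <;> decide
    · decide
    · intro x
      unfold linkSubst
      split_ifs
      · simp [size]
      · simp [size]
      · exact size_rowOR_le _ _
      · simp [size]
    · intro x c
      unfold linkSubst
      split_ifs
      · simp
      · simp
      · exact altDepthAux_clauseOf_le _ _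
      · simp

/-- **Column exclusion chain**: `⊢ ¬p_{uw} ∨ ¬colOR k v w, ¬R'` for `w < k+1`, `u < v`,
`v + t = k+2`, from the hole (injectivity) clauses `¬p_{uw} ∨ ¬p_{vw}`.
[Ben-Sasson 2002, §3] [folklore] -/
theorem colExclS {D B : ℕ} (hD : 13 ≤ D) (hB : 3000 * (k + 3) ^ 4 ≤ B) :
    ∀ (t u w v : ℕ), w < k + 1 → u < v → v + t = k + 2 →
      BD D B (chainLines k t) (disjList [colExcl k u w v, neg (ontoPhp (k + 1))])
  | 0, u, w, v, _, _, hv => by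
    rw [chainLines, colExcl, colOR_end (by omega)]
    exact exclBaseS _ hD hB
  | t + 1, u, w, v, hw, huv, hv => by
    have ih := colExclS hD hB t u w (v + 1) hw (by omega) (by omega)
    have hvk : v < k + 2 := by omega
    rw [chainLines]
    -- the hole clause `¬p_{uw} ∨ ¬p_{vw}`
    have hmem : [(u * (k + 1) + w, false), (v * (k + 1) + w, false)] ∈
        ontoPigeonholeCNF (k + 1 + 1) (k + 1) :=
      mem_ontoPigeonholeCNF_of_mem (KEval.mem_pigeonholeCNF_iff.2
        (Or.inr ⟨w, hw, v, by omega, u, huv, rfl⟩))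
    have hex := ontoClauseExtractS (D := D) (k + 1) hmem (by omega) (extractB_of_le k hB)
    have hszR := size_ontoPhp_le (k + 1)
    have e : colExcl k u w v = (disj (neg (var 0)) (neg (disj (var 1) (var 2)))).subst
        (linkSubst (u * (k + 1) + w) (v * (k + 1) + w) (colOR k (v + 1) w)) := by
      rw [colExcl, colOR_step hvk]; rfl
    rw [e]
    refine skeletonStep2S (G₁ := clauseOf [(0, false), (1, false)])
      (G₂ := disj (neg (var 0)) (neg (var 2))) [0, 1, 2] (by decide) (by simp) ?_ ?_ ?_ ?_
      (Z₁ := Z₁ k) (SR := SR k) ?_ (by simp) ?_ (dd_neg_ontoPhp_le _) (by simpa using hszR)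
      (by simpa [linkSubst, clauseOf, disjList, litOf, PropForm.subst] using hex)
      (by simpa [linkSubst, colExcl, PropForm.subst] using ih) hD (stepB_of_le k hB)
    · intro A hA x hx
      simp only [List.mem_cons, List.not_mem_nil, or_false] at hA
      rcases hA with rfl | rfl | rfl <;>
        simp [PropForm.vars, clauseOf, disjList, litOf] at hx <;> simp <;> omega
    · intro τ h1 h2
      simp only [eval_clauseOf, List.any_cons, List.any_nil, Bool.or_false, Literal.eval,
        PropForm.eval] at h1 h2 ⊢
      revert h1 h2
      cases τ 0 <;> cases τ 1 <;> cases τ 2 <;> simp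
    · intro A hA
      simp only [List.mem_cons, List.not_mem_nil, or_false] at hA
      rcases hA with rfl | rfl | rfl <;> decide
    · decide
    · intro x
      unfold linkSubst
      split_ifs
      · simp [size]
      · simp [size]
      · exact size_colOR_le _ _
      · simp [size]
    · intro x c
      unfold linkSubst
      split_ifs
      · simp
      · simp
      · exact altDepthAux_clauseOf_le _ _
      · simp

end Summit.PneNP.PneNP.Theorems.GridRouting
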